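import Mathlib
import Literature.Probability.LatticeModels.TorusFourHypercube
import Literature.MathematicalPhysics.QuantumLattice.HeisenbergModel
import Summits.HubbardSuperconductivity.HubbardSuperconductivity.Theorems.LevyLogBootstrapBlock2InfDivXXZFourCheckB

/-!
# Crux `Block2InfDivXXZ` (stmt-HubbardSuperconductivity-15048), `M = 4` slice: definitions of the
# soundness proof of the certificate

All non-computational definitions used by the proof files `…Four{Spectral,TableSound,Config,Symm,
Action,Action2,Obs,PF,Gram,Bridge,CellPoly,Cell,Assembly}` (which are definition-free):

* the weighted coordinate space of the abstract enclosure lemma (`wip`, `mulVecR`);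
* the bundled table fact `TableFacts`;
* the dictionary between spin configurations of the `4 × 4` torus and bit lists (`vEquiv`, `bitsOf`,
  `confOf`), good vertex permutations `GoodPerm` and the graph automorphisms `siteAut` they induce
  (with the finite facts `vidx_vsite`, `vsite_vidx`, `vidx_lt`, `vsite_injective` their definition needs);
* classes, representatives and symmetric vectors (`cls`, `repConf`, `symVec`, `halfSet`);
* the Hamiltonian `H4`, exchanged configurations `swapConf`, Ising weights `qq`, the class-coordinate
  Hamiltonian `CR`/`CRr`, the radial observables `A4` and their tables `TR`, `allPairs`, `Nw`;
* range-indexed real class vectors (`nR`, `wipN`, `castL`, `C1r`, `yhat`) and their `Fin 74` forms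
  (`nF`, `CF`, `TF`, `fv`, `ext`).
-/

set_option linter.dupNamespace false

namespace Summit.HubbardSuperconductivity.HubbardSuperconductivity.Theorems.LevyLogBootstrap

namespace FourCert

noncomputable section

open List Finset Literature.Probability.LatticeModels Literature.Probability.LatticeModels.TorusFour
  Literature.MathematicalPhysics.QuantumLattice Matrix

/-! ### Weighted coordinate space -/

/-- The weighted inner product `⟪u, v⟫ₙ = Σ_a n_a u_a v_a`. [folklore] -/
def wip {ι : Type*} [Fintype ι] (n u v : ι → ℝ) : ℝ := ∑ a, n a * (u a * v a)

/-- Real matrix–vector product on coordinates, `(M z)_a = Σ_b M_ab z_b`. [folklore] -/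
def mulVecR {ι : Type*} [Fintype ι] (M : ι → ι → ℝ) (z : ι → ℝ) : ι → ℝ := fun a => ∑ b, M a b * z b

/-! ### The table facts -/

/-- The three kernel-checked facts about the orbit table. -/
structure TableFacts : Prop where
  /-- `tableCheckWords = true` -/
  words : tableCheckWords = true
  /-- `tableCheckGlobal = true` -/
  global : tableCheckGlobal = true
  /-- `tableCheckRange 0 12870 = true` -/
  range : tableCheckRange 0 12870 = true

/-! ### Sites and vertices -/

/-- `vidx ∘ vsite = id` on `v < 16`. -/
theorem vidx_vsite : ∀ v : Fin 16, vidx (vsite v.val) = v.val := by decide +kernel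

/-- `vsite ∘ vidx = id`, and `vidx < 16`, coordinate form. -/
theorem vsite_vidx_vec : ∀ a b : ZMod 4, vsite (vidx ![a, b]) = ![a, b] ∧ vidx ![a, b] < 16 := by
  decide +kernel

/-- `vsite (vidx x) = x`. -/
theorem vsite_vidx (x : TorusSite 2 4) : vsite (vidx x) = x := by
  rw [eq_vec x]; exact (vsite_vidx_vec _ _).1

/-- `vidx x < 16`. -/
theorem vidx_lt (x : TorusSite 2 4) : vidx x < 16 := by
  rw [eq_vec x]; exact (vsite_vidx_vec _ _).2

/-- The vertex numbering as an equivalence `Fin 16 ≃ TorusSite 2 4`. -/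
def vEquiv : Fin 16 ≃ TorusSite 2 4 where
  toFun v := vsite v.val
  invFun x := ⟨vidx x, vidx_lt x⟩
  left_inv v := Fin.ext (vidx_vsite v)
  right_inv x := vsite_vidx x

/-- `vsite` is injective on `v, w < 16`. -/
theorem vsite_injective {v w : ℕ} (hv : v < 16) (hw : w < 16) (h : vsite v = vsite w) : v = w := by
  have := congrArg vidx h
  rwa [show v = (⟨v, hv⟩ : Fin 16).val from rfl, vidx_vsite, show w = (⟨w, hw⟩ : Fin 16).val from rfl,
    vidx_vsite] at this

/-! ### Configurations as bit lists -/

/-- The bit list of a configuration: entry `v` is the spin at `vsite v` (`0` up, `1` down). -/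
def bitsOf (σ : TensorIndex (TorusSite 2 4) 2) : List ℕ := (List.range 16).map fun v => (σ (vsite v)).val

/-- The configuration of a bit list. -/
def confOf (bs : List ℕ) : TensorIndex (TorusSite 2 4) 2 := fun x => if bs.getD (vidx x) 0 = 1 then 1 else 0

/-! ### Good vertex permutations and the automorphisms they induce -/

/-- A **good vertex permutation**: a list of length `16` that is a permutation of `range 16`
preserving the Hamming distance of vertex indices. -/
structure GoodPerm (g : List ℕ) : Prop where
  /-- length `16` -/
  len : g.length = 16
  /-- permutation -/
  perm : g.Perm (List.range 16)
  /-- the Hamming distance is preserved -/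
  ham : ∀ v w, v < 16 → w < 16 → hamming (g.getD v 0) (g.getD w 0) = hamming v w

/-- Entries of a good permutation are `< 16`. -/
theorem GoodPerm.getD_lt {g : List ℕ} (hg : GoodPerm g) (v : ℕ) : g.getD v 0 < 16 := by
  rw [List.getD_eq_getElem?_getD]
  cases h : g[v]? with
  | none => simp
  | some a =>
    simp only [Option.getD_some]
    have : a ∈ List.range 16 := hg.perm.subset (List.mem_of_getElem? h)
    exact List.mem_range.1 this

/-- Indexing a good permutation is injective on `v, w < 16`. -/
theorem GoodPerm.getD_injective {g : List ℕ} (hg : GoodPerm g) {v w : ℕ} (hv : v < 16) (hw : w < 16)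
    (h : g.getD v 0 = g.getD w 0) : v = w := by
  have hnd : g.Nodup := hg.perm.nodup_iff.2 List.nodup_range
  rw [List.getD_eq_getElem?_getD, List.getD_eq_getElem?_getD,
    List.getElem?_eq_getElem (by rw [hg.len]; exact hv), List.getElem?_eq_getElem (by rw [hg.len]; exact hw),
    Option.getD_some, Option.getD_some] at h
  exact (hnd.getElem_inj_iff).1 h

/-- The site map of a vertex permutation. -/
def siteAutFun (g : List ℕ) (x : TorusSite 2 4) : TorusSite 2 4 := vsite (g.getD (vidx x) 0)

/-- The site map of a good permutation is a bijection. -/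
theorem siteAutFun_bijective {g : List ℕ} (hg : GoodPerm g) : Function.Bijective (siteAutFun g) := by
  refine (Finite.injective_iff_bijective).1 fun x y h => ?_
  have h1 := vsite_injective (hg.getD_lt _) (hg.getD_lt _) h
  have h2 := hg.getD_injective (vidx_lt x) (vidx_lt y) h1
  rw [← vsite_vidx x, ← vsite_vidx y, h2]

/-- **The graph automorphism of the `4 × 4` torus induced by a good vertex permutation.** -/
def siteAut {g : List ℕ} (hg : GoodPerm g) : TorusSite 2 4 ≃ TorusSite 2 4 :=
  Equiv.ofBijective _ (siteAutFun_bijective hg)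

/-! ### Classes, representatives, symmetric vectors -/

/-- The class (orbit index) of a configuration. -/
def cls (σ : TensorIndex (TorusSite 2 4) 2) : ℕ := clsBits (bitsOf σ)

/-- The representative configuration of class `a`. -/
def repConf (a : ℕ) : TensorIndex (TorusSite 2 4) 2 := confOf (repsBits.getD a [])

/-- The symmetric vector of a class vector `z`: `v_z(σ) = z (cls σ)` on the half-filled sector,
`0` elsewhere. -/
def symVec (z : ℕ → ℝ) (σ : TensorIndex (TorusSite 2 4) 2) : ℂ :=
  if (bitsOf σ).sum = 8 then ((z (cls σ) : ℝ) : ℂ) else 0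

/-- The half-filled configurations. -/
def halfSet : Finset (TensorIndex (TorusSite 2 4) 2) := Finset.univ.filter fun σ => (bitsOf σ).sum = 8

/-! ### The Hamiltonian and the observables -/

/-- The Hamiltonian of the crux at `M = 4`. -/
abbrev H4 (Δ : ℝ) : Op (TorusSite 2 4) 2 := xxzHamiltonian 1 (torusGraph 2 4) (-1) Δ

/-- The configuration with the spins at `x` and `y` exchanged. -/
def swapConf (σ : TensorIndex (TorusSite 2 4) 2) (x y : TorusSite 2 4) : TensorIndex (TorusSite 2 4) 2 :=
  Function.update (Function.update σ x (σ y)) y (σ x)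

/-- The parallel/antiparallel weight `s_x s_y = ± ¼`. -/
def qq (u v : Fin 2) : ℂ := if u = v then (1 / 4 : ℂ) else -(1 / 4 : ℂ)

/-- The Hamiltonian in class coordinates (real): `(C(Δ) w)_a = -Δ (diag4_a/4) w_a - ½ Σ_b hop_ab w_b`. -/
def CR (Δ : ℝ) (w : ℕ → ℝ) (a : ℕ) : ℝ :=
  -Δ * ((diag4.getD a 0 : ℤ) : ℝ) / 4 * w a -
    (1 / 2 : ℝ) * ∑ b ∈ Finset.range 74, (((hopTab.getD a []).getD b 0 : ℕ) : ℝ) * w b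

/-- The radial transverse observable `A_h = Σ_{x,y : grayWeight (x - y) = h} S⁺_x S⁻_y`. -/
def A4 (hh : ℕ) : Matrix (TensorIndex (TorusSite 2 4) 2) (TensorIndex (TorusSite 2 4) 2) ℂ :=
  ∑ x : TorusSite 2 4, ∑ y : TorusSite 2 4,
    if grayWeight (x - y) = hh then onSite x (spinRaise 1) * onSite y (spinLower 1) else 0

/-- The raise–lower table in class coordinates: `(T_h w)_a = Σ_{b<74} tTab(h)_ab w_b`. -/
def TR (hh : ℕ) (w : ℕ → ℝ) (a : ℕ) : ℝ :=
  ∑ b ∈ Finset.range 74, ((((tTab hh).getD a []).getD b 0 : ℕ) : ℝ) * w b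

/-- All ordered vertex pairs. -/
def allPairs : List (ℕ × ℕ) := (List.range 16).flatMap fun x => (List.range 16).map fun y => (x, y)

/-- The number of ordered site pairs at Gray distance `h`, as a real number. -/
def Nw (hh : ℕ) : ℝ := ∑ x : TorusSite 2 4, ∑ y : TorusSite 2 4, if grayWeight (x - y) = hh then (1 : ℝ) else 0

/-! ### Range-indexed real class vectors -/

/-- The orbit sizes as reals. -/
def nR (a : ℕ) : ℝ := (orbitSize.getD a 0 : ℝ)

/-- The weighted inner product on range-indexed class vectors, `Σ_{a<74} n_a u_a v_a`. -/
def wipN (u v : ℕ → ℝ) : ℝ := ∑ a ∈ Finset.range 74, nR a * (u a * v a)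

/-- A rational list as a real class vector. -/
def castL (u : List ℚ) (a : ℕ) : ℝ := ((u.getD a 0 : ℚ) : ℝ)

/-- `C(Δ)` on range-indexed real class vectors (same formula as `FourCert.CR`). -/
def CRr (Δ : ℝ) (w : ℕ → ℝ) (a : ℕ) : ℝ :=
  -Δ * ((diag4.getD a 0 : ℤ) : ℝ) / 4 * w a -
    (1 / 2 : ℝ) * ∑ b ∈ Finset.range 74, (((hopTab.getD a []).getD b 0 : ℕ) : ℝ) * w b

/-- The diagonal operator `C¹`: `(C¹ w)_a = -(diag_a/4) w_a`. -/
def C1r (w : ℕ → ℝ) (a : ℕ) : ℝ := -(((diag4.getD a 0 : ℤ) : ℝ) / 4) * w a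

/-- The trial vector `ŷ(δ) = ŷ₀ + δ ŷ₁` of a cell. -/
def yhat (d : CellData) (δ : ℝ) (a : ℕ) : ℝ := castL d.y0L a + δ * castL d.y1L a

/-! ### The `Fin 74` forms -/

/-- Orbit sizes on `Fin 74`. -/
def nF (a : Fin 74) : ℝ := nR a.val

/-- `C(Δ)` as a `Fin 74` matrix. -/
def CF (Δ : ℝ) (a b : Fin 74) : ℝ :=
  (if a = b then -Δ * ((diag4.getD a.val 0 : ℤ) : ℝ) / 4 else 0) -
    (1 / 2 : ℝ) * (((hopTab.getD a.val []).getD b.val 0 : ℕ) : ℝ)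

/-- `T_h` as a `Fin 74` matrix. -/
def TF (hh : ℕ) (a b : Fin 74) : ℝ := ((((tTab hh).getD a.val []).getD b.val 0 : ℕ) : ℝ)

/-- A range-indexed class vector on `Fin 74`. -/
def fv (u : ℕ → ℝ) (a : Fin 74) : ℝ := u a.val

/-- A `Fin 74` vector as a range-indexed class vector (zero beyond `74`). -/
def ext (w : Fin 74 → ℝ) (a : ℕ) : ℝ := if h : a < 74 then w ⟨a, h⟩ else 0

end

end FourCert

end Summit.HubbardSuperconductivity.HubbardSuperconductivity.Theorems.LevyLogBootstrap
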